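import Mathlib
import HarnessLib
import HarnessLib.Audit
import Summits.CriticalPhenomena.Statement
import Literature.Probability.RandomPlanarGeometry.SLE
import Literature.Probability.LatticeModels.MedialWinding
import HarnessLib.Audit.Status.Attr
-- import Summits.CriticalPhenomena.CardyFormulaZ2.Theorems.CardyComplexConeSLESixFamiliesGiveCardy dropped: it (transitively) imports this route file — proofs used by `closes`/`_holds` must live in a module that does not import the Theses file

/-!
Route: CardySusyWard

# Route CardySusyWard — the missing Cauchy-Riemann half of the q=1 parafermion as a dynamic-SUSY
Ward identity, then Morera, SLE6 and Cardy

It suffices to show X = X1 ∧ X2 ∧ X3 for the q = 1 FK parafermionic VERTEX observable of bond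
percolation on δℤ² at p = 1/2,
F_δ(z) = E[Σ_{passages of the Dobrushin exploration interface through the medial vertex z}
exp(−(i/3)·W(z))] (library: `passageSum (medialExploration (Λ δ) ω) δ (1/3) z` under
`bondPercolation (zdGraph 2) half`, spin σ = 1/3), stated — since the route repair of 2026-08-15 —
in FAMILY FORM: for every Dobrushin domain D = (Ω; a, b) and EVERY admissible square-lattice
discretisation family Λ : ℝ → DiscreteDobrushin of D (the six `ZdDiscretisationFamily` fields,
unbundled: vertex set meshDomain Ω δ, mesh δ, wired arc → (ab) and dual-wired arc → (ba) and
discrete marks → {a, b} in Hausdorff distance, `IsZdAdmissible` for all small δ), instead of the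
canonical data `dobrushinData D δ` behind the guard `∀ᶠ δ, IsZdAdmissible`, which is false at every
mesh on the unit disc (`not_isZdAdmissible_dobrushinData_unitDisc`) and along δ_k → 0 on
axis-aligned rectangles and made the first rendering generically vacuous (grounder g14-2, refuter
route-review, repair unit d761fd15 concur):
X1 (WeakHolomorphy, realises card susy-ward-second-cauchy-riemann K2–K3): the discrete ∂̄ of F_δ
vanishes in the scaling limit in the weak sense, δ^{5/3} Σ_z F_δ(z)·∂̄φ(z_δ) → 0 for every test
function φ ∈ C_c^∞(Ω) — BOTH halves of the discrete Cauchy–Riemann relations in the limit, the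
vertex half being exact on the lattice (Duminil-Copin 2012 Prop. 4) and the dual half being the one
the card proposes to obtain as a Ward identity of the dynamic lattice supersymmetry of
TL(n=1)/XXZ(Δ=−1/2) (mechanism items SusyTransferIntertwiner, QExactPlaquette, informal until their
definition requests land);
X2 (ParafermionPrecompact): δ^{−1/3}F_δ is uniformly bounded and equicontinuous on compacts of Ω,
eventually in δ (the Duminil-Copin–Smirnov normalisation of Conjecture 8.7 is tight);
X3 (ParafermionFamiliesToSLESix): X1 and X2 identify the limit (φ′)^{1/3} (DCS Conj. 8.7 at q = 1)
and, through the observable martingale, the interface limit as SLE₆ (DCS Conj. 8.8) for every D and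
every admissible family Λ — the conclusion is, up to repackaging the six fields (Lean-checked),
Literature's `SLE6LimitZ2AllDiscretisations`, INLINED over the interface `CurveClass.mk (orientation
of medialExplorationCurve (Λ δ) ω)` (definitionally `bondInterfaceIn D (Λ δ)`) so that the open
conjecture is a waypoint this route proves and not a named dependency in its cone; Cardy then
follows by the shared family-form dictionary SLESixFamiliesGiveCardy (= CardyComplexCone's
stmt-9654; crossing event ↔ interface hitting event, κ > 4 hitting sandwich, LSW's SLE₆ hitting
law), with DiscretisationFamilyExists (= stmt-9644) as the non-vacuity certificate.
Lean: `(∀ (D : Literature.Probability.RandomPlanarGeometry.DobrushinDomain) (Λ : ℝ →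
Literature.Probability.LatticeModels.DiscreteDobrushin), (∀ δ, (Λ δ).Ω = D.carrier) → (∀ δ, (Λ δ).δ
= δ) → Filter.Tendsto (fun δ : ℝ => Metric.hausdorffEDist (Λ δ).arcA (D.arc 0)) (nhdsWithin (0:ℝ)
(Set.Ioi 0)) (nhds 0) → Filter.Tendsto (fun δ : ℝ => Metric.hausdorffEDist (Λ δ).arcB (D.arc 1))
(nhdsWithin (0:ℝ) (Set.Ioi 0)) (nhds 0) → Filter.Tendsto (fun δ : ℝ => Metric.hausdorffEDist
(Literature.Probability.LatticeModels.medialPoint δ '' (Λ δ).zdABEdges) {D.pt 0, D.pt 1})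
(nhdsWithin (0:ℝ) (Set.Ioi 0)) (nhds 0) → (∀ᶠ δ in nhdsWithin (0:ℝ) (Set.Ioi 0), (Λ
δ).IsZdAdmissible) → ∀ (φ : ℂ → ℂ), ContDiff ℝ (⊤ : ℕ∞) φ → HasCompactSupport φ → tsupport φ ⊆
D.carrier → Filter.Tendsto (fun δ : ℝ => ((δ ^ ((5:ℝ) / 3) : ℝ) : ℂ) * ∑ᶠ z :
Literature.Probability.LatticeModels.MedialVertex, (∫ ω,
Literature.Probability.LatticeModels.passageSum
(Literature.Probability.LatticeModels.medialExploration (Λ δ) ω) δ (1 / 3) z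
∂(Literature.Probability.Percolation.bondPercolation (Literature.Probability.LatticeModels.zdGraph
2) Literature.Probability.Percolation.half)) * ((fderiv ℝ φ
(Literature.Probability.LatticeModels.medialPoint δ z) 1 + Complex.I * fderiv ℝ φ
(Literature.Probability.LatticeModels.medialPoint δ z) Complex.I) / 2)) (nhdsWithin 0 (Set.Ioi 0))
(nhds 0)) ∧ (∀ (D : Literature.Probability.RandomPlanarGeometry.DobrushinDomain) (Λ : ℝ →
Literature.Probability.LatticeModels.DiscreteDobrushin), (∀ δ, (Λ δ).Ω = D.carrier) → (∀ δ, (Λ δ).δ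
= δ) → Filter.Tendsto (fun δ : ℝ => Metric.hausdorffEDist (Λ δ).arcA (D.arc 0)) (nhdsWithin (0:ℝ)
(Set.Ioi 0)) (nhds 0) → Filter.Tendsto (fun δ : ℝ => Metric.hausdorffEDist (Λ δ).arcB (D.arc 1))
(nhdsWithin (0:ℝ) (Set.Ioi 0)) (nhds 0) → Filter.Tendsto (fun δ : ℝ => Metric.hausdorffEDist
(Literature.Probability.LatticeModels.medialPoint δ '' (Λ δ).zdABEdges) {D.pt 0, D.pt 1})
(nhdsWithin (0:ℝ) (Set.Ioi 0)) (nhds 0) → (∀ᶠ δ in nhdsWithin (0:ℝ) (Set.Ioi 0), (Λ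
δ).IsZdAdmissible) → ∀ K : Set ℂ, IsCompact K → K ⊆ D.carrier → (∃ C : ℝ, ∀ᶠ δ in nhdsWithin (0:ℝ)
(Set.Ioi 0), ∀ z : Literature.Probability.LatticeModels.MedialVertex,
Literature.Probability.LatticeModels.medialPoint δ z ∈ K → ‖(∫ ω,
Literature.Probability.LatticeModels.passageSum
(Literature.Probability.LatticeModels.medialExploration (Λ δ) ω) δ (1 / 3) z
∂(Literature.Probability.Percolation.bondPercolation (Literature.Probability.LatticeModels.zdGraph
2) Literature.Probability.Percolation.half))‖ ≤ C * δ ^ ((1:ℝ) / 3)) ∧ (∀ ε > (0:ℝ), ∃ η > (0:ℝ), ∀ᶠ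
δ in nhdsWithin (0:ℝ) (Set.Ioi 0), ∀ z z' : Literature.Probability.LatticeModels.MedialVertex,
Literature.Probability.LatticeModels.medialPoint δ z ∈ K →
Literature.Probability.LatticeModels.medialPoint δ z' ∈ K → dist
(Literature.Probability.LatticeModels.medialPoint δ z)
(Literature.Probability.LatticeModels.medialPoint δ z') < η → ‖(∫ ω,
Literature.Probability.LatticeModels.passageSum
(Literature.Probability.LatticeModels.medialExploration (Λ δ) ω) δ (1 / 3) z
∂(Literature.Probability.Percolation.bondPercolation (Literature.Probability.LatticeModels.zdGraph
2) Literature.Probability.Percolation.half)) - (∫ ω, Literature.Probability.LatticeModels.passageSum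
(Literature.Probability.LatticeModels.medialExploration (Λ δ) ω) δ (1 / 3) z'
∂(Literature.Probability.Percolation.bondPercolation (Literature.Probability.LatticeModels.zdGraph
2) Literature.Probability.Percolation.half))‖ ≤ ε * δ ^ ((1:ℝ) / 3))) ∧ (∀ (D :
Literature.Probability.RandomPlanarGeometry.DobrushinDomain) (Λ : ℝ →
Literature.Probability.LatticeModels.DiscreteDobrushin), (∀ δ, (Λ δ).Ω = D.carrier) → (∀ δ, (Λ δ).δ
= δ) → Filter.Tendsto (fun δ : ℝ => Metric.hausdorffEDist (Λ δ).arcA (D.arc 0)) (nhdsWithin (0:ℝ)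
(Set.Ioi 0)) (nhds 0) → Filter.Tendsto (fun δ : ℝ => Metric.hausdorffEDist (Λ δ).arcB (D.arc 1))
(nhdsWithin (0:ℝ) (Set.Ioi 0)) (nhds 0) → Filter.Tendsto (fun δ : ℝ => Metric.hausdorffEDist
(Literature.Probability.LatticeModels.medialPoint δ '' (Λ δ).zdABEdges) {D.pt 0, D.pt 1})
(nhdsWithin (0:ℝ) (Set.Ioi 0)) (nhds 0) → (∀ᶠ δ in nhdsWithin (0:ℝ) (Set.Ioi 0), (Λ
δ).IsZdAdmissible) → Literature.Probability.RandomPlanarGeometry.ConvergesInLawToSLE 6 D (Ωδ := fun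
_ => Literature.Probability.Percolation.BondConfig (Literature.Probability.LatticeModels.Site 2))
(fun δ ω => Literature.Probability.RandomPlanarGeometry.CurveClass.mk (if dist
(Literature.Probability.LatticeModels.medialExplorationCurve (Λ δ) ω 0) (D.pt 0) ≤ dist
(Literature.Probability.LatticeModels.medialExplorationCurve (Λ δ) ω 0) (D.pt 1) then
(⟨Literature.Probability.LatticeModels.medialExplorationCurve (Λ δ) ω⟩ :
Literature.Probability.RandomPlanarGeometry.Curve ℂ) else
⟨(Literature.Probability.LatticeModels.medialExplorationCurve (Λ δ) ω).comp ⟨unitInterval.symm,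
unitInterval.continuous_symm⟩⟩)) (fun _ => Literature.Probability.Percolation.bondPercolation
(Literature.Probability.LatticeModels.zdGraph 2) Literature.Probability.Percolation.half))`

## Assembly
Pure logic (modus ponens; the deciding theorem `closes (hWeak) (hPrecompact) (hToSLE) (hCardy) :
CardyFormulaZ2 := hCardy (hToSLE hWeak hPrecompact)` is certified natively, axioms
propext/Classical.choice/Quot.sound): X1 and X2 feed ParafermionFamiliesToSLESix, whose conclusion
(SLE₆ for all admissible discretisation families) is verbatim the antecedent of
SLESixFamiliesGiveCardy. All mathematical content sits in the four items; the SUSY mechanism enters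
only as the intended proof of WeakHolomorphy (informal items SusyTransferIntertwiner,
QExactPlaquette, with definition requests for the percolation strip transfer matrix in the
link-pattern representation and the Fendley–Yang supercharge). No named unproved Literature fact is
a hypothesis anywhere on the line: the SLE₆ curve at κ = 6 is the proved `exists_isSLECurve_six`,
Cardy for SLE₆ is the discharged `sle_six_measureReal_hitsBefore`, and a.e.-measurability of the
family interface is part of what ParafermionFamiliesToSLESix proves.

Rationale: WHY THIS LINE. Smirnov's programme at q = 1 stalls at exactly one place: the parafermionic edge
observable of spin σ = 1/3 satisfies only the vertex relations F(NW) − F(SE) = i[F(NE) − F(SW)]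
(DuminilCopinSmirnov2012Lattice Prop. 8.6, DuminilCopin2012Parafermion Prop. 4: "we do not know
anything around vertices of G*"), and the catalogued barrier
FKParafermionicHalfCauchyRiemann(Narrow) shows these are exactly closedness of an edge form, so no
SAME-SIZE exact identity of that shape can ever supply the dual (curl) half; what Morera
identification needs is only the ASYMPTOTIC dual half plus precompactness (barrier evasion (b)). The
card's mechanism for the asymptotic dual half is a symmetry specific to q = 1 and not yet spent on
observables: bond percolation's strip transfer matrix is TL(n=1) = six-vertex/XXZ at Δ = −1/2, which
carries a DYNAMIC N = 2 lattice supersymmetry — a nilpotent length-raising supercharge Q : V^L →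
V^{L+1}, a signed sum of local site insertions, with H Q = Q H (YangFendley2004;
HagendorfLienardy2017 §2) and, for the double-row transfer matrix with the matching K-matrices, T Q
= (a+b)² Q T at every spectral parameter (HagendorfLienardy2020 Prop. 3.7; WestonYang2017 for the
six-vertex case); in Saleur1992's continuum dictionary percolation is a twisted N = 2 theory in
which ∂̄ of protected fields is Q-exact, so the missing relation should be a lattice SUSY WARD
IDENTITY ⟨{Q, Λ}⟩ = boundary terms, of cross-size (L versus L+1) type, outside the barrier's
technique class by construction. Imported areas: quantum integrability / lattice supersymmetry of
spin chains (the supercharge, one-boundary Temperley–Lieb representation theory behind the "magic"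
isospectrality of DegierEtAl2005), the quantum-affine-current reading of discrete holomorphicity
(IkhlefEtAl2013, where the "dual conservation law" is named as the missing piece), and the
Kemppainen–Smirnov/CDHKS martingale machinery already layered in the tree for q = 2. No prior route
of the sub types the q = 1 parafermion at all (CardyDiscreteHolo/CardyHarmonicInvariants work with
Smirnov's separation probabilities; CardyViaSLE6/CardyRotToConf upgrade symmetries of interface
limits); the negatives index (one SAW tightness artefact) is untouched, and its lesson
(eventual-in-δ quantifiers) is applied in every statement below. Statement form (route repair
2026-08-15): every lattice statement is in FAMILY FORM — quantified over all admissible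
square-lattice discretisation families Λ of the Dobrushin domain (the six ZdDiscretisationFamily
fields, unbundled), as in the reviewed renderings crit-ising.S17 / SLE6LimitZ2AllDiscretisations and
in the sibling route CardyComplexCone — because the canonical-data guard of the first rendering is
false on discs and rectangles (not_isZdAdmissible_dobrushinData_unitDisc;
InterfaceScalingLimitDiscretised.lean §2); and no named unproved Literature fact is a hypothesis or
a waypoint constant of any item (SLE₆ convergence is inlined; the κ = 6 curve is the proved
exists_isSLECurve_six), so the route's dependency cone is definitions down to Mathlib.

RANKED CRUXES. #2 WeakHolomorphy (crux) — For every Dobrushin domain D = (Ω; a, b), every admissible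
discretisation family Λ of D (vertex set meshDomain Ω δ, mesh δ, arcs → (ab), (ba) and marks → {a,
b} in Hausdorff distance, IsZdAdmissible eventually) and every smooth compactly supported test
function φ with support in Ω, δ^{5/3} · Σ_{medial vertices z} F_δ(z) · ∂̄φ(medialPoint δ z) → 0 as δ
→ 0⁺, where F_δ(z) = ∫ passageSum (medialExploration (Λ δ) ω) δ (1/3) z dP_{1/2} is the q = 1,
spin-1/3 parafermionic vertex observable of the exploration interface of Λ δ and ∂̄φ = (∂_xφ +
i∂_yφ)/2 (card K2–K3: the SUSY Ward identity is to deliver the dual half; the vertex half is DC2012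
Prop. 4). [difficulty: open-problem] (why it might fail: the dual plaquette circulations may have a
non-vanishing weak limit at scale δ^{1/3} (a genuinely non-holomorphic σ-form limit), or {Q,·} may
only regenerate the known vertex relations; chirality/normalisation conventions of passageSum could
also misplace the statement (repairable: conj F_δ / spin −1/3).) [DuminilCopinSmirnov2012Lattice,
DuminilCopin2012Parafermion, IkhlefEtAl2013, HagendorfLienardy2020, Saleur1992]
#3 ParafermionPrecompact (crux) — For every such D, Λ and every compact K ⊂ Ω: (i) ∃ C, eventually
in δ, |F_δ(z)| ≤ C δ^{1/3} for all medial vertices z with medialPoint δ z ∈ K; (ii) ∀ ε > 0 ∃ η > 0,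
eventually in δ, |F_δ(z) − F_δ(z′)| ≤ ε δ^{1/3} whenever both points lie in K at distance < η — i.e.
δ^{−1/3}F_δ is precompact in C(K) (tightness of the (2δ)^{−σ} normalisation of DCS Conjecture 8.7 at
σ = 1/3). [difficulty: XL] (why it might fail: |F_δ(z)| ≤ P(z ∈ γ) ≍ δ^{1/4} (polychromatic 2-arm) ≫
δ^{1/3}; the bound needs winding-phase cancellation of order δ^{1/12} with no s-holomorphic
primitive (the q = 2 tool) available; a lattice-scale staggered component could spoil
equicontinuity.) [DuminilCopinSmirnov2012Lattice, Smirnov2010, Zhou2024SLE6BondZ2]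
#4 ParafermionFamiliesToSLESix (crux; family form of the shared item ParafermionToSLESix 5651, which
stays with CardyComplexCone) — WeakHolomorphy → ParafermionPrecompact → (SLE₆ for every D and every
admissible family Λ, interface = CurveClass of the re-oriented medial exploration curve of Λ δ,
definitionally bondInterfaceIn D (Λ δ); ⇔ SLE6LimitZ2AllDiscretisations by field repackaging): weak
holomorphy plus precompactness make every subsequential limit of δ^{−1/3}F_δ holomorphic
(Weyl/Morera); the boundary argument condition on the free arc (DuminilCopin2012Parafermion Prop. 5)
and the primitive of f³ identify it as c·(φ′)^{1/3}, φ the conformal map to the strip (DCS Conj.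
8.7, q = 1); the domain-Markov martingale F_δ in slit domains, Kemppainen–Smirnov precompactness
(RSW, known for bond-ℤ²) and Lévy's characterisation give the driving process √6·B (DCS Conj. 8.8) —
the q = 1 replica of the tree's FK-Ising layers (exists_observableMartingale_fkInterface …); the
SLE₆ curve object is the proved exists_isSLECurve_six and the eventual a.e.-measurability inside
ConvergesInLawToSLE is a cylinder-event statement (template aemeasurable_triInterface_holds). [deps:
WeakHolomorphy, ParafermionPrecompact] [difficulty: XL] (why it might fail: the martingale step
needs X1–X2 UNIFORMLY over discrete slit domains (Carathéodory), which the per-domain statements do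
not give for free; without the F²-primitive of q = 2 the Riemann–Hilbert identification near rough
boundary arcs may fail to pin the limit; arbitrary Jordan domains with arbitrary admissible families
is Camia–Newman generality.) [DuminilCopinSmirnov2012Lattice, Smirnov2010, KemppainenSmirnov2017,
CDHKSCRAS2014, DuminilCopin2012Parafermion, CamiaNewman2007]
#5 SLESixFamiliesGiveCardy (crux; shared verbatim with CardyComplexCone 9654, replaces the
canonical-form support SLESixGivesCardy 0697 on this route) — (SLE₆ for every D and every admissible
family) → CardyFormulaZ2: for a conformal rectangle (Ω; a, b, c, d) run the interface of (Ω; a, c)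
along a discretisation family (DiscretisationFamilyExists), identify G02's free-boundary crossing
(ab)_δ ↔ (cd)_δ with 'the interface hits (cd)_δ before (bc)_δ' up to boundary events killed by
half-plane arm / RSW bounds, pass to the limit through the κ > 4 hitting sandwich and finish with
LSW's SLE₆ hitting law = Cardy (sle_six_measureReal_hitsBefore, discharged). [difficulty: L] (why it
might fail: the free crossing event of discreteCrossing (largest component, distance-rule arcs with
ties) must equal the Dobrushin hitting event up to o(1); at rough marked prime ends ℤ² boundary arm
bounds may not control the difference.) [CamiaNewman2007, Smirnov2001, LawlerSchrammWerner2001,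
Werner2009, AizenmanBurchard1999]
#9 DiscretisationFamilyExists (support; shared verbatim with CardyComplexCone 9644) — every
Dobrushin domain admits an admissible discretisation family (the non-vacuity certificate of the
family form the refuter route-review asked for; expected witness: arcs rotated by a mesh-dependent
angle ≍ δ; not a hypothesis of the deciding theorem). [difficulty: L] [CDHKSCRAS2014, Smirnov2001,
ChelkakSmirnov2012]
Support items 5 SusyTransferIntertwiner / 6 QExactPlaquette (the SUSY mechanism feeding
WeakHolomorphy) stay informal until the definition requests land. Dropped on this route by the
repair: ParafermionToSLESix 5651 (canonical form; kept by CardyComplexCone), SLESixGivesCardy 0697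
(canonical waypoint SLE6LimitZ2; kept by five sibling routes), AEMeasurableBondInterface 7157
(canonical-data measurability, no longer on the line: the family interface's measurability is part
of #4's conclusion), ExistsSLECurve 7285 (over-strong: the global fact is equivalent to the
open-in-tree SLE₈ trace theorem, while the load-bearing κ = 6 instance exists_isSLECurve_six is
proved).

TWO-LAYER PLAN. Foreseen glued splits (none filed now): WeakHolomorphy ⇐ SusyTransferIntertwiner →
QExactPlaquette → WeakHolomorphy (the Ward identity summed against test functions, boundary terms
o(δ^{-5/3}·…)); ParafermionFamiliesToSLESix ⇐ UniformSlitUpgrade → RiemannHilbertIdentification →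
MartingaleToSLESix; ParafermionPrecompact ⇐ BulkBound → Equicontinuity (k ≤ 3, depth 1).
SLESixFamiliesGiveCardy ⇐ InterfaceDictionaryFamilies → HittingSandwichLimit (k = 2) if it is
attacked here rather than on CardyComplexCone.

KILL CRITERIA. A proof that NO local nilpotent length-raising map intertwines the free-boundary
percolation strip transfer matrices (¬SusyTransferIntertwiner for some width L ≤ 8, by exact linear
algebra) kills the MECHANISM: close `refuted:SusyTransferIntertwiner` unless QExactPlaquette can be
re-based on a non-local intertwiner (then pivot note). A certified non-zero weak limit of the dual
circulations (¬WeakHolomorphy) refutes X1 and DCS Conjecture 8.7's holomorphy at q = 1 — close the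
route and hand the witness to the barrier catalogue. ¬ParafermionPrecompact (δ^{-1/3}|F_δ| unbounded
in the bulk) refutes the DCS normalisation: pivot to the δ^{-1/4}-normalised or phase-stripped
observable only if X1 survives. If WeakHolomorphy fails only by complex conjugation (conj F_δ weakly
holomorphic) that is a convention artefact: restate, do not close. SLE₆ convergence for all
admissible families proved elsewhere (CardyComplexCone, or SLE6LimitZ2AllDiscretisations discharged
by the interface programme of CardyViaSLE6/CardyRotToConf) moots X3 and #5 but not X1–X2 nor the
finite-size SUSY identities, which stay as theorems about ℤ² percolation.
¬DiscretisationFamilyExists for some Jordan domain would not refute the line but would send the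
whole family-form vocabulary (shared with the Ising statements) back to Literature for repair.

NOT DECOMPOSED YET. The interior of WeakHolomorphy (which local Λ, which boundary states are
Q-covariant, the size of boundary terms), the uniform-over-slit-domains upgrade and the boundary
Riemann–Hilbert analysis inside ParafermionFamiliesToSLESix, the bulk bound versus equicontinuity
inside ParafermionPrecompact, and the typed form of the two SUSY cruxes (awaiting the definition
requests) the crossing/interface dictionary inside SLESixFamiliesGiveCardy — all layer-2 children
once a crux closes or a definition lands.

CHEAPEST FALSIFIER. Exact linear algebra, no probability (kit, ℚ(√3) or ℚ(ζ₁₂)): for widths L ≤ 7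
build the TL(n=1) link-pattern transfer matrices t_L, t_{L+1} of bond percolation on the strip with
free sides at the isotropic point and compute the space of solutions X of t_{L+1} X = λ X t_L over
the common eigenvalues λ; SUSY predicts a non-zero solution supported on LOCAL single-site
insertions with alternating signs (the image of Q = Σ(−1)^j q_j) and X∘X = 0. Empty or only
non-local solutions ⇒ SusyTransferIntertwiner is dead and the route loses its engine. Not run here
(plancard seat, no kit payload); the literature half of the check WAS run: HagendorfLienardy2020
Prop. 3.7 gives T Q = (a+b)² Q T only for the diagonal K-matrices of boundary fields p = p′ = −1/4,
not for the U_q(sl₂)-invariant free boundary K = 1 of percolation, and DegierEtAl2005 records only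
spectral inclusion spec(L) ⊂ spec(L) ∪ spec(L+1) for the stochastic TL chain — so the descent is
genuinely undecided in print.

NUMBERS. σ = 1 − (2/π)arccos(√q/2) = 1/3 at q = 1; κ = 4π/arccos(−√q/2) = 6; bulk 2-arm exponent 1/4
versus observable scaling δ^{1/3} (winding-phase gain 1/12 = σ²κ/8); half-plane 1-arm exponent 1/3 =
σ (boundary size of F_δ); SUSY: Δ = −1/2, E₀ = −(3L−1)/4 shift, T Q = (a+b)² Q T with c² = a² + ab +
b² (six-vertex, d = 0), K⁻ = 1 + b/(2a+b)·σ³, K⁺ = 1 − a/(a+2b)·σ³ (HagendorfLienardy2020 eq. DefKpm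
at d = 0, y = 0). Items after the repair of 2026-08-15: 6 typed (4 cruxes
WeakHolomorphy/ParafermionPrecompact/ParafermionFamiliesToSLESix/SLESixFamiliesGiveCardy, 1 support
DiscretisationFamilyExists, 1 assembly) + 2 informal support items (SusyTransferIntertwiner,
QExactPlaquette) + the deciding theorem closes; medial density 2/δ², F_δ ≍ δ^{1/3}·f ⇒ δ^{5/3}Σ_z
F_δ ∂̄φ → 2∫ f ∂̄φ (refuter content check: exponent 5/3 right, '→ 0' presumes the bound of #3(i)).

DEFINITION REQUESTS. D1 PercolationStripTransferMatrix (topic Literature/Probability/LatticeModels):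
the link-pattern (planar boundary-connectivity) state space W_L of bond percolation on {1,…,L} × ℤ
with free vertical sides, the Temperley–Lieb(n = 1) generators e_j on it, the double-row transfer
matrix t_L(u) with K = 1 (isotropic point u = π/6… in the chosen parametrisation), and the
dictionary expressing rectangle crossing probabilities under bondPercolation (zdGraph 2) half as
matrix elements ⟨out| t_L^M |in⟩ (Baxter–Kelland–Wu / Blöte–Nienhuis). D2 FendleyYangSupercharge
(topic Literature/MathematicalPhysics/QuantumLattice): q|↓⟩ = |↑↑⟩, q|↑⟩ = 0, Q = Σ_j (−1)^j q_j :
(ℂ²)^{⊗L} → (ℂ²)^{⊗(L+1)}, Q² = 0, H = QQ† + Q†Q the open XXZ(Δ = −1/2) chain with fields −(σ³_1 +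
σ³_L)/4 (HagendorfLienardy2017 §2), and the transfer-matrix relation T Q = (a+b)² Q T
(HagendorfLienardy2020 Prop. 3.7, d = 0) as a cite fact. Informal statement items filed after open:
SusyTransferIntertwiner (rank 5), QExactPlaquette (rank 6). D3 ZdDiscretisationFamily (filed by the
first repair unit as defn-ZdDiscretisationFamily) has LANDED as
Literature/Probability/LatticeModels/DobrushinDiscretisation.lean; the items spell its six fields
out (unbundled) so that they elaborate against the light imports and coincide verbatim with
CardyComplexCone's 9654/9644, and MedialWinding.lean is the fact-free home of passageSum for this
vocabulary.

Novelty: Searches (2026-08-15): `lit search --source crossref "supersymmetric eight-vertex model transfer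
matrix"` (10; found HagendorfLienardy2020/2018, Rosengren 2015), `lit search --source zbmath
"lattice supersymmetry XXZ"` (10; HagendorfLienardy2017, WestonYang2017, YangFendley2004,
Fendley–Nienhuis–Schoutens 2003), `lit search --source zbmath "supersymmetry Ward identity
parafermionic observable discrete holomorphicity"` (0), `lit search --source crossref "lattice
supersymmetry percolation observable square lattice"` (8, none relevant), `lit frontier
CriticalPhenomena --since 2020` (30 descendants; none on lattice SUSY or q = 1 parafermions), `lit
bridges CriticalPhenomena --cross any` (30; none), `lit galaxy search "dynamic lattice
supersymmetry" --star all` (galaxyd queue timeout, 0 rows; the card's own galaxy query had found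
only Rosengren arXiv:1503.02833 and a UCLouvain thesis); arXiv/S2/OpenAlex endpoints rate-limited
(429) at filing; read in full text: HagendorfLienardy2020 §3.2 (Prop. 3.7, K-matrices),
HagendorfLienardy2017 §§1–2 (supercharge, boundary fields, isospectrality remark),
DuminilCopinSmirnov2012Lattice §8.3 (Prop. 8.6, Conj. 8.7–8.8).
Nearest prior art found: IkhlefEtAl2013 (arXiv:1302.4649: the KNOWN half as conservation of
U_q(sl₂^) currents, the dual law named missing); HagendorfLienardy2020 Prop. 3.7 / WestonYang2017
(transfer-matrix SUSY, used only for ground states and spectra); DegierEtAl2005 (spectral L/L+1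
"magic" of the stochastic TL chain); hub car  [refs: 1503.02833, 1302.4649, HagendorfLienardy2020, HagendorfLienardy2017, WestonYang2017, YangFendley2004, IkhlefEtAl2013, DegierEtAl2005]

Barriers (technique_class: lattice-supersymmetry ward-identity parafermionic-observable): - technique_class: lattice-supersymmetry ward-identity parafermionic-observable
- Literature.Barriers.CriticalPhenomena.FKParafermionicHalfCauchyRiemann: applies to the starting
object and is the route's target; evaded in letter and in plan — the barrier (and its Narrow form)
blocks discrete-level DETERMINATION from same-size vertex relations, and lists Morera identification
from an ASYMPTOTIC second relation plus precompactness as outside the class (evasion (b));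
WeakHolomorphy/ParafermionPrecompact are exactly that, and the SUSY identities feeding them relate
sizes L and L+1, which the |V|-versus-|E| count does not see. If {Q,·} only regenerates vertex
relations the barrier wins (kill criterion).
- Literature.Barriers.CriticalPhenomena.FKParafermionicHalfCauchyRiemannNarrow: evaded the same way
as its parent — the route never tries to DETERMINE F_δ at the discrete level from the vertex
relations (closedness of the edge form); it asks for the asymptotic dual relation in weak form
(WeakHolomorphy) plus precompactness and then Morera/Weyl identification of limits, which the Narrow
form itself lists as outside the class (its evasion (b)); the new exact input is cross-size (L ↔
L+1) SUSY identities, not further same-size plaquette relations.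
- Literature.Barriers.CriticalPhenomena.ParafermionicHalfCauchyRiemann: the hexagonal-lattice SAW
companion of the same shape (vertex relations + boundary values under-determine the observable); met
only through the shared token parafermioni

History (route lifecycle, newest last):
- 2026-08-15T16:56:21Z · rev 2: restated WeakHolomorphy (stmt-CriticalPhenomena-5649), ParafermionPrecompact (stmt-CriticalPhenomena-5650), Assembly (stmt-CriticalPhenomena-5652) — route-repair 2026-08-15 (cone guardrail + statement defect), one transaction: (1) FAMILY-FORM restatement of WeakHolomorphy 5649 / ParafermionPrecompact 5650 (a (planner-rbadge-CriticalPhenomena-CardySusyWard-d761fd15-g4-0)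
- 2026-08-15T16:56:21Z · rev 2: dropped ParafermionToSLESix, SLESixGivesCardy, AEMeasurableBondInterface, ExistsSLECurve — route-repair 2026-08-15 (cone guardrail + statement defect), one transaction: (1) FAMILY-FORM restatement of WeakHolomorphy 5649 / ParafermionPrecompact 5650 (a (planner-rbadge-CriticalPhenomena-CardySusyWard-d761fd15-g4-0)

sub-problem: CardyFormulaZ2 · status: open · opened planner-plancard-CriticalPhenomena-CardyFormu-d116baf6-0 2026-08-15T11:42:01Z · rev 5 · ledger route-CriticalPhenomena-CardySusyWard
GENERATED by the gate from the ledger (D-0016/17). Provers cite these decls: `theorem foo : Summit.CriticalPhenomena.CardyFormulaZ2.Theses.CardySusyWard.<Decl> := …` in Summits/CriticalPhenomena/CardyFormulaZ2/Theorems/<Name>.lean.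
-/

namespace Summit.CriticalPhenomena.CardyFormulaZ2.Theses.CardySusyWard

open scoped BigOperators Topology Manifold Classical MeasureTheory ProbabilityTheory Matrix InnerProductSpace ComplexConjugate ContinuousMap
open Filter Set Function TopologicalSpace MeasureTheory

attribute [summit_statement] _root_.CardyFormulaZ2

-- earlier WeakHolomorphy (stmt-CriticalPhenomena-5649, replaced 2026-08-15T16:56:21Z -> stmt-CriticalPhenomena-11292): retired by None — ∀ (D : Literature.Probability.RandomPlanarGeometry.DobrushinDomain), (∀ᶠ δ in nhdsWithin (0:ℝ) (Set.Ioi 0), (Literature.Probability.Percolation.dobrushinData D δ).IsZdAdmissible) → ∀ (φ : ℂ → ℂ), ContDiff ℝ (⊤ : ℕ∞) φ → HasCompactSupport φ → tsupport φ ⊆ D.carrier 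
/-- item stmt-CriticalPhenomena-11292 · crux · rank 2 · open · by planner
why it might fail: Open = dual half of DCS2012 Conj. 8.7 at q=1 (only F(N)−F(S)=i[F(E)−F(W)] known, arXiv:1109.1549 p.36; 'dual equation is missing', arXiv:1302.4649 p.20): plaquette circulations may keep a non-zero weak limit at scale δ^{1/3}, or {Q,·} may only regenerate vertex relations (barrier class).
sources: DuminilCopinSmirnov2012Lattice, DuminilCopin2012Parafermion, IkhlefEtAl2013, lean:Literature.Barriers.CriticalPhenomena.FKParafermionicHalfCauchyRiemann_holds, HagendorfLienardy2020, Saleur1992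
[crux] (family form, route repair 2026-08-15) For every Dobrushin domain D = (Ω; a, b), every
admissible square-lattice discretisation family Λ of D (the six ZdDiscretisationFamily fields
unbundled: vertex set meshDomain Ω δ, mesh δ, wired arc → (ab) and dual-wired arc → (ba) and
discrete marks → {a, b} in Hausdorff distance, IsZdAdmissible for all small δ) and every smooth
compactly supported test function φ with support in Ω, δ^{5/3} · Σ_{medial vertices z} F_δ(z) ·
∂̄φ(medialPoint δ z) → 0 as δ → 0⁺, where F_δ(z) = ∫ passageSum (medialExploration (Λ δ) ω) δ (1/3)
z dP_{1/2} is the q = 1, spin-1/3 parafermionic vertex observable of the exploration interface of Λ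
δ (medialExploration is the definiens of fkInterface) and ∂̄φ = (∂_xφ + i∂_yφ)/2 (card
susy-ward-second-cauchy-riemann K2–K3: the SUSY Ward identity is to deliver the dual half; the
vertex half is DC2012 Prop. 4). Replaces the canonical-data rendering, vacuous on discs/rectangles
(not_isZdAdmissible_dobrushinData_unitDisc). [difficulty: open-problem] -/
@[route_item "route-CriticalPhenomena-CardySusyWard", crux]
def WeakHolomorphy : Prop :=
  ∀ (D : Literature.Probability.RandomPlanarGeometry.DobrushinDomain) (Λ : ℝ → Literature.Probability.LatticeModels.DiscreteDobrushin), (∀ δ, (Λ δ).Ω = D.carrier) → (∀ δ, (Λ δ).δ = δ) → Filter.Tendsto (fun δ : ℝ => Metric.hausdorffEDist (Λ δ).arcA (D.arc 0)) (nhdsWithin (0:ℝ) (Set.Ioi 0)) (nhds 0) → Filter.Tendsto (fun δ : ℝ => Metric.hausdorffEDist (Λ δ).arcB (D.arc 1)) (nhdsWithin (0:ℝ) (Set.Ioi 0)) (nhds 0) → Filter.Tendsto (fun δ : ℝ => Metric.hausdorffEDist (Literature.Probability.LatticeModels.medialPoint δ '' (Λ δ).zdABEdges) {D.pt 0, D.pt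 1}) (nhdsWithin (0:ℝ) (Set.Ioi 0)) (nhds 0) → (∀ᶠ δ in nhdsWithin (0:ℝ) (Set.Ioi 0), (Λ δ).IsZdAdmissible) → ∀ (φ : ℂ → ℂ), ContDiff ℝ (⊤ : ℕ∞) φ → HasCompactSupport φ → tsupport φ ⊆ D.carrier → Filter.Tendsto (fun δ : ℝ => ((δ ^ ((5:ℝ) / 3) : ℝ) : ℂ) * ∑ᶠ z : Literature.Probability.LatticeModels.MedialVertex, (∫ ω, Literature.Probability.LatticeModels.passageSum (Literature.Probability.LatticeModels.medialExploration (Λ δ) ω) δ (1 / 3) z ∂(Literature.Probability.Percolation.bondPercolation (Literature.Probability.LatticeModels.zdGraph 2) Literature.Probability.Percolation.half)) * ((fderiv ℝ φ (Literature.Probability.LatticeModels.medialPoint δ z) 1 + Complex.I * fderiv ℝ φ (Literature.Probability.LatticeModels.medialPoint δ z) Complex.I) / 2)) (nhdsWithin 0 (Set.Ioi 0)) (nhds 0)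

-- earlier ParafermionPrecompact (stmt-CriticalPhenomena-5650, replaced 2026-08-15T16:56:21Z -> stmt-CriticalPhenomena-11293): retired by None — ∀ (D : Literature.Probability.RandomPlanarGeometry.DobrushinDomain), (∀ᶠ δ in nhdsWithin (0:ℝ) (Set.Ioi 0), (Literature.Probability.Percolation.dobrushinData D δ).IsZdAdmissible) → ∀ K : Set ℂ, IsCompact K → K ⊆ D.carrier → (∃ C : ℝ, ∀ᶠ δ in nhdsWithin (0:ℝ)
/-- item stmt-CriticalPhenomena-11293 · crux · rank 3 · open · by planner
why it might fail: AS TYPED ⇔ δ^{-1/3}F_δ→0 on compacts (z,z′ range over Sym2 (Site 2); non-edge pairs share medialPoint, carry F_δ≡0 and collapse (ii); 5 refuter Lean certs): false under DCS Conj. 8.7 — needs edgeSet guards. Repaired content open: |F_δ|≤2P(z∈γ)≍δ^{1/4}≫δ^{1/3} needs δ^{1/12} phase cancellation on ℤ².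
sources: DuminilCopinSmirnov2012Lattice, Smirnov2010, SmirnovWerner2001, KemppainenSmirnov2017, Zhou2024SLE6BondZ2, lean:Literature.Probability.LatticeModels.MedialVertex
[crux] (family form, route repair 2026-08-15) For every such D, Λ and every compact K ⊂ Ω: (i) ∃ C,
eventually in δ, |F_δ(z)| ≤ C δ^{1/3} for all medial vertices z with medialPoint δ z ∈ K; (ii) ∀ ε >
0 ∃ η > 0, eventually in δ, |F_δ(z) − F_δ(z′)| ≤ ε δ^{1/3} whenever both points lie in K at distance
< η — i.e. δ^{−1/3}F_δ is precompact in C(K) (tightness of the (2δ)^{−σ} normalisation of DCS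
Conjecture 8.7 at σ = 1/3), F_δ(z) = ∫ passageSum (medialExploration (Λ δ) ω) δ (1/3) z dP_{1/2}.
[difficulty: XL] -/
@[route_item "route-CriticalPhenomena-CardySusyWard", crux]
def ParafermionPrecompact : Prop :=
  ∀ (D : Literature.Probability.RandomPlanarGeometry.DobrushinDomain) (Λ : ℝ → Literature.Probability.LatticeModels.DiscreteDobrushin), (∀ δ, (Λ δ).Ω = D.carrier) → (∀ δ, (Λ δ).δ = δ) → Filter.Tendsto (fun δ : ℝ => Metric.hausdorffEDist (Λ δ).arcA (D.arc 0)) (nhdsWithin (0:ℝ) (Set.Ioi 0)) (nhds 0) → Filter.Tendsto (fun δ : ℝ => Metric.hausdorffEDist (Λ δ).arcB (D.arc 1)) (nhdsWithin (0:ℝ) (Set.Ioi 0)) (nhds 0) → Filter.Tendsto (fun δ : ℝ => Metric.hausdorffEDist (Literature.Probability.LatticeModels.medialPoint δ '' (Λ δ).zdABEdges) {D.pt 0, D.pt 1}) (nhdsWithin (0:ℝ) (Set.Ioi 0)) (nhds 0) → (∀ᶠ δ in nhdsWithin (0:ℝ) (Set.Ioi 0), (Λ δ).IsZdAdmissible)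 → ∀ K : Set ℂ, IsCompact K → K ⊆ D.carrier → (∃ C : ℝ, ∀ᶠ δ in nhdsWithin (0:ℝ) (Set.Ioi 0), ∀ z : Literature.Probability.LatticeModels.MedialVertex, Literature.Probability.LatticeModels.medialPoint δ z ∈ K → ‖(∫ ω, Literature.Probability.LatticeModels.passageSum (Literature.Probability.LatticeModels.medialExploration (Λ δ) ω) δ (1 / 3) z ∂(Literature.Probability.Percolation.bondPercolation (Literature.Probability.LatticeModels.zdGraph 2) Literature.Probability.Percolation.half))‖ ≤ C * δ ^ ((1:ℝ) / 3)) ∧ (∀ ε > (0:ℝ), ∃ η > (0:ℝ), ∀ᶠ δ in nhdsWithin (0:ℝ) (Set.Ioi 0), ∀ z z' : Literature.Probability.LatticeModels.MedialVertex, Literature.Probability.LatticeModels.medialPoint δ z ∈ K → Literature.Probability.LatticeModels.medialPoint δ z' ∈ K → dist (Literature.Probability.LatticeModels.medialPoint δ z) (Literature.Probability.LatticeModels.medialPoint δ z') < η → ‖(∫ ω, Literature.Probability.LatticeModels.passageSum (Literature.Probability.LatticeModels.medialExploration (Λ δ) ω) δ (1 / 3) z ∂(Literature.Probability.Percolation.bondPercolation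 (Literature.Probability.LatticeModels.zdGraph 2) Literature.Probability.Percolation.half)) - (∫ ω, Literature.Probability.LatticeModels.passageSum (Literature.Probability.LatticeModels.medialExploration (Λ δ) ω) δ (1 / 3) z' ∂(Literature.Probability.Percolation.bondPercolation (Literature.Probability.LatticeModels.zdGraph 2) Literature.Probability.Percolation.half))‖ ≤ ε * δ ^ ((1:ℝ) / 3))

/-- item stmt-CriticalPhenomena-10814 · crux · rank 4 · open · by planner
why it might fail: Takes ParafermionPrecompact BY NAME: as typed that hypothesis ⇔ vanishing, so the item is vacuous if F_δ≍δ^{1/3}, else the bare SLE₆ conjecture. Repaired: no non-degeneracy (lim≠0) hypothesis; martingale step needs X1–X2 uniformly on rough slit domains + free-arc control without a q=2 F²-primitive.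
sources: DuminilCopinSmirnov2012Lattice, KemppainenSmirnov2017, CDHKSCRAS2014, DuminilCopin2012Parafermion, Smirnov2010, CamiaNewman2007
[crux] (route-repair 2026-08-15: family form of ParafermionToSLESix stmt-5651, which stays with
route CardyComplexCone) WeakHolomorphy → ParafermionPrecompact → (SLE₆ for EVERY Dobrushin domain D
and EVERY admissible square-lattice discretisation family Λ of D): the six ZdDiscretisationFamily
fields are unbundled — vertex set meshDomain D δ, mesh δ, wired arc → (ab) and dual-wired arc → (ba)
and discrete marks → {a,b} in Hausdorff distance, IsZdAdmissible for all small δ — and the interface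
is the CurveClass of the medial exploration curve of Λ δ re-oriented a → b (definitionally
Literature bondInterfaceIn D (Λ δ), checked by rfl); the two antecedents are this route's cruxes
WeakHolomorphy / ParafermionPrecompact BY NAME (same idiom as CardyComplexCone.CoherentMorera; they
follow the family-form restatement of 2026-08-15) and the conclusion is verbatim the antecedent of
SLESixFamiliesGiveCardy (stmt-9654), equivalent by field repackaging (Lean-checked) to Literature
SLE6LimitZ2AllDiscretisations — INLINED so that the open conjecture is a waypoint the route proves,
not a named dependency in its cone. Content: weak holomorphy + precompactness make every
subsequential limit of δ^{-1/3 -/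
@[route_item "route-CriticalPhenomena-CardySusyWard", crux]
def ParafermionFamiliesToSLESix : Prop :=
  WeakHolomorphy → ParafermionPrecompact → (∀ (D : Literature.Probability.RandomPlanarGeometry.DobrushinDomain) (Λ : ℝ → Literature.Probability.LatticeModels.DiscreteDobrushin), (∀ δ, (Λ δ).Ω = D.carrier) → (∀ δ, (Λ δ).δ = δ) → Filter.Tendsto (fun δ : ℝ => Metric.hausdorffEDist (Λ δ).arcA (D.arc 0)) (nhdsWithin (0:ℝ) (Set.Ioi 0)) (nhds 0) → Filter.Tendsto (fun δ : ℝ => Metric.hausdorffEDist (Λ δ).arcB (D.arc 1)) (nhdsWithin (0:ℝ) (Set.Ioi 0)) (nhds 0) → Filter.Tendsto (fun δ : ℝ => Metric.hausdorffEDist (Literature.Probability.LatticeModels.medialPoint δ '' (Λ δ).zdABEdges) {D.pt 0, D.pt 1}) (nhdsWithin (0:ℝ) (Set.Ioi 0)) (nhds 0) → (∀ᶠ δ in nhdsWithin (0:ℝ) (Set.Ioi 0), (Λ δ).IsZdAdmissible) → Literature.Probability.RandomPlanarGeometry.ConvergesInLawToSLE 6 D (Ωδ := fun _ => Literature.Probability.Percolation.BondConfig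 (Literature.Probability.LatticeModels.Site 2)) (fun δ ω => Literature.Probability.RandomPlanarGeometry.CurveClass.mk (if dist (Literature.Probability.LatticeModels.medialExplorationCurve (Λ δ) ω 0) (D.pt 0) ≤ dist (Literature.Probability.LatticeModels.medialExplorationCurve (Λ δ) ω 0) (D.pt 1) then (⟨Literature.Probability.LatticeModels.medialExplorationCurve (Λ δ) ω⟩ : Literature.Probability.RandomPlanarGeometry.Curve ℂ) else ⟨(Literature.Probability.LatticeModels.medialExplorationCurve (Λ δ) ω).comp ⟨unitInterval.symm, unitInterval.continuous_symm⟩⟩)) (fun _ => Literature.Probability.Percolation.bondPercolation (Literature.Probability.LatticeModels.zdGraph 2) Literature.Probability.Percolation.half))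

-- item stmt-CriticalPhenomena-6789 · support · rank 5 · open · by planner — informal only, no Lean statement yet:
--   [crux] (informal until the definition requests PercolationStripTransferMatrix /
--   FendleyYangSupercharge land; the MECHANISM crux feeding WeakHolomorphy, card
--   susy-ward-second-cauchy-riemann K1) SUSY descends to the percolation strip: for every width L ≥ 1
--   there is a linear map ι_L : W_L → W_{L+1} between the Temperley–Lieb(n=1) link-pattern (planar
--   boundary-connectivity) state spaces of bond percolation on the strip {1,…,L} × ℤ with FREE vertical
--   sides, of the form ι_L = Σ_j (−1)^j (local strand/site insertion at position j), with ι_{L+1} ∘ ι_L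
--   = 0 and t_{L+1}(u) ∘ ι_L = λ_L(u) · ι_L ∘ t_L(u) f

/-- item stmt-CriticalPhenomena-9654 · support · rank 5 · closed · proved by Summit.CriticalPhenomena.CardyFormulaZ2.Cruxes.SLESixFamiliesGiveCardy.CollarTouchSandwich.SLESixFamiliesGiveCardy_of (prover) · by planner
sources: Smirnov2001, CamiaNewman2007, LawlerSchrammWerner2001, Werner2009, AizenmanBurchard1999, lean:Literature.Probability.RandomPlanarGeometry.sle_six_measureReal_hitsBefore_holds
[crux] (SLE₆ for every Dobrushin domain and every discretisation family, =
SLE6LimitZ2AllDiscretisations) → CardyFormulaZ2: for a conformal rectangle R = (Ω; a, b, c, d) take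
the Dobrushin domain (Ω; a, c), build an admissible discretisation family
(DiscretisationFamilyExists), identify the free-boundary discrete crossing (ab)_δ ↔ (cd)_δ of
bondDomainCrossingProb R with 'the interface hits (cd)_δ before (bc)_δ' up to boundary events killed
by half-plane arm / RSW bounds, use a.s. continuity of hitsBefore at SLE₆ samples and LSW's hitting
law = Cardy (Literature.Probability.RandomPlanarGeometry.sle_six_measureReal_hitsBefore,
discharged). Template on 𝕋: Camia–Newman 2007 §§5–7, Smirnov 2001. [deps: ParafermionToSLESix,
DiscretisationFamilyExists] [difficulty: L] (why it might fail: the free crossing event of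
discreteCrossing (largest component, distance-rule arcs with ties) must equal the Dobrushin hitting
event up to o(1); at rough marked prime ends ℤ² boundary arm bounds may not control the difference,
and a discretisation family must exist for every (Ω; a, c).) [sources: CamiaNewman2007, Smirnov2001,
LawlerSchrammWerner2001, Werner2009, AizenmanBurchard1999, lean:Literature.Proba -/
@[route_item "route-CriticalPhenomena-CardySusyWard", crux]
def SLESixFamiliesGiveCardy : Prop :=
  (∀ (D : Literature.Probability.RandomPlanarGeometry.DobrushinDomain) (Λ : ℝ → Literature.Probability.LatticeModels.DiscreteDobrushin), (∀ δ, (Λ δ).Ω = D.carrier) → (∀ δ, (Λ δ).δ = δ) → Filter.Tendsto (fun δ : ℝ => Metric.hausdorffEDist (Λ δ).arcA (D.arc 0)) (nhdsWithin (0:ℝ) (Set.Ioi 0)) (nhds 0) → Filter.Tendsto (fun δ : ℝ => Metric.hausdorffEDist (Λ δ).arcB (D.arc 1)) (nhdsWithin (0:ℝ) (Set.Ioi 0)) (nhds 0) → Filter.Tendsto (fun δ : ℝ => Metric.hausdorffEDist (Literature.Probability.LatticeModels.medialPoint δ '' (Λ δ).zdABEdges) {D.pt 0, D.pt 1}) (nhdsWithin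 (0:ℝ) (Set.Ioi 0)) (nhds 0) → (∀ᶠ δ in nhdsWithin (0:ℝ) (Set.Ioi 0), (Λ δ).IsZdAdmissible) → Literature.Probability.RandomPlanarGeometry.ConvergesInLawToSLE 6 D (Ωδ := fun _ => Literature.Probability.Percolation.BondConfig (Literature.Probability.LatticeModels.Site 2)) (fun δ ω => Literature.Probability.RandomPlanarGeometry.CurveClass.mk (if dist (Literature.Probability.LatticeModels.medialExplorationCurve (Λ δ) ω 0) (D.pt 0) ≤ dist (Literature.Probability.LatticeModels.medialExplorationCurve (Λ δ) ω 0) (D.pt 1) then (⟨Literature.Probability.LatticeModels.medialExplorationCurve (Λ δ) ω⟩ : Literature.Probability.RandomPlanarGeometry.Curve ℂ) else ⟨(Literature.Probability.LatticeModels.medialExplorationCurve (Λ δ) ω).comp ⟨unitInterval.symm, unitInterval.continuous_symm⟩⟩)) (fun _ => Literature.Probability.Percolation.bondPercolation (Literature.Probability.LatticeModels.zdGraph 2) Literature.Probability.Percolation.half)) → CardyFormulaZ2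

-- item stmt-CriticalPhenomena-6803 · support · rank 6 · open · by planner — informal only, no Lean statement yet:
--   [crux] (informal; card susy-ward-second-cauchy-riemann K2, the Ward identity proper) Q-exactness of
--   the dual plaquette circulation: in the vertex (six-vertex / U_q(sl₂^)-current) representation of the
--   q = 1 parafermionic edge observable of bond percolation on ℤ² — F(e) = a matrix element, between
--   transfer-matrix products, of a conserved quantum-affine current j(e) dressed by a tail
--   (Ikhlef–Weston–Wheeler–Zinn-Justin, IkhlefEtAl2013 §§4–5 and §9, where the vertex relations of
--   Duminil-Copin–Smirnov Prop. 8.6 ARE current conservation and 'the dual equation is missing') — there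
--   is, at every dual v

/-- item stmt-CriticalPhenomena-9644 · support · rank 9 · closed · proved by Summit.CriticalPhenomena.CardyFormulaZ2.Theorems.DiscretisationFamilyExists_proof @ 387f8440f586 (prover) · by planner
sources: ChelkakSmirnov2012, CDHKSCRAS2014, Smirnov2001, lean:Literature.Probability.LatticeModels.isDiscretisation_discData, lean:Literature.Probability.Percolation.not_isZdAdmissible_dobrushinData_unitDisc
[support] CONSTRUCTION statement for the interface the cruxes are stated over: every Dobrushin
domain D admits a family Λ : ℝ → DiscreteDobrushin with (Λ δ).Ω = D.carrier, (Λ δ).δ = δ, arcs →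
(ab), (ba) and discrete marked points (midpoints of the A–B edges) → {a, b} in Hausdorff distance,
and ℤ²-admissible data for all small δ > 0 (i.e. IsDiscretisation D Λ, unbundled). Expected witness:
arcs rotated by a mesh-dependent angle ≍ δ so that no boundary site is equidistant from the two arcs
(InterfaceScalingLimitDiscretised.lean, docstring §2 — not formalised for any domain yet). Certifies
that the family-form items are not vacuous; consumed by SLESixFamiliesGiveCardy. Risk: a Jordan
boundary so rough near a mark that every choice leaves an A–B edge without an inner face at
infinitely many meshes. [difficulty: L] [sources: CDHKS2014, Smirnov2001, ChelkakSmirnov2012,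
lean:Literature.Probability.Percolation.not_isZdAdmissible_dobrushinData_unitDisc] -/
@[route_item "route-CriticalPhenomena-CardySusyWard"]
def DiscretisationFamilyExists : Prop :=
  ∀ (D : Literature.Probability.RandomPlanarGeometry.DobrushinDomain), ∃ Λ : ℝ → Literature.Probability.LatticeModels.DiscreteDobrushin, (∀ δ, (Λ δ).Ω = D.carrier) ∧ (∀ δ, (Λ δ).δ = δ) ∧ Filter.Tendsto (fun δ : ℝ => Metric.hausdorffEDist (Λ δ).arcA (D.arc 0)) (nhdsWithin (0:ℝ) (Set.Ioi 0)) (nhds 0) ∧ Filter.Tendsto (fun δ : ℝ => Metric.hausdorffEDist (Λ δ).arcB (D.arc 1)) (nhdsWithin (0:ℝ) (Set.Ioi 0)) (nhds 0) ∧ Filter.Tendsto (fun δ : ℝ => Metric.hausdorffEDist (Literature.Probability.LatticeModels.medialPoint δ '' (Λ δ).zdABEdges) {D.pt 0, D.pt 1}) (nhdsWithin (0:ℝ) (Set.Ioi 0)) (nhds 0) ∧ (∀ᶠ δ in nhdsWithin (0:ℝ) (Set.Ioi 0), (Λ δ).IsZdAdmissible)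

-- earlier Assembly (stmt-CriticalPhenomena-5652, replaced 2026-08-15T16:56:21Z -> stmt-CriticalPhenomena-11294): retired by None — WeakHolomorphy → ParafermionPrecompact → ParafermionToSLESix → SLESixGivesCardy → CardyFormulaZ2
/-- item stmt-CriticalPhenomena-11294 · assembly · rank 1 · closed · proved by Summit.CriticalPhenomena.CardyFormulaZ2.Theorems.cardySusyWard_assembly_proof @ 0c1e476ca277 (prover) · by planner
sources: DuminilCopinSmirnov2012Lattice, Smirnov2001
[assembly] WeakHolomorphy → ParafermionPrecompact → ParafermionFamiliesToSLESix →
SLESixFamiliesGiveCardy → CardyFormulaZ2 (the deciding theorem closes is `hCardy (hToSLE hWeak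
hPrecompact)`). -/
@[route_item "route-CriticalPhenomena-CardySusyWard"]
def Assembly : Prop :=
  WeakHolomorphy → ParafermionPrecompact → ParafermionFamiliesToSLESix → SLESixFamiliesGiveCardy → CardyFormulaZ2

/-! D-0027 §2.1 — DECIDING THEOREM (planner-authored via `route open/edit --closes-file`; by planner-rbadge-CriticalPhenomena-CardySusyWard-d761fd15-g4-0 2026-08-15T16:56:21Z):
its hypotheses are this route's items and its conclusion the sub-problem Statement (glue_lint), and it elaborates with this file. -/

@[closes "route-CriticalPhenomena-CardySusyWard"] theorem closes (hWeak : WeakHolomorphy) (hPrecompact : ParafermionPrecompact) (hToSLE : ParafermionFamiliesToSLESix) (hCardy : SLESixFamiliesGiveCardy) : _root_.CardyFormulaZ2 :=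
  hCardy (hToSLE hWeak hPrecompact)

end Summit.CriticalPhenomena.CardyFormulaZ2.Theses.CardySusyWard
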